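import Literature.MathematicalPhysics.QuantumFieldTheory.Balaban1983to89.B12Eq213GaussianLastCoupling

/-!
# `Balaban1983to89.B12Eq213GaussianSmallFieldMass` — T. Bałaban, *Renormalization group approach to lattice gauge field theories. I*,
Commun. Math. Phys. **109** (1987) 249–301 [Balaban1987RG1], (2.9) p. 266 and (2.13) p. 268; *… II. Cluster expansions*, Commun. Math.
Phys. **116** (1988) 1–22 [Balaban1988RG2Cluster], (2.22) p. 16 and (2.25) p. 17: **the DAMPED SMALL-FIELD MASS
`∫ χ_k e^{−½α|B|²} dμ_{C^{(k)}}` of the product cut-off (2.9) at the Gaussian datum is bounded BELOW explicitly —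
`≥ √(det M∕det(M + α)) − e^{−½γ₂r²}·#S·√(det M∕det(M + α − γ₂))` — so that every constant of the seat's last-coupling moduli
(`B12Eq213GaussianLastCoupling`) is an explicit Gaussian quantity of the datum; kernel-checked**

statement-level skeleton of published theorems with citation tags; proofs where landed; nothing here is a claim about
the Yang–Mills mass gap

PDF held: `paper:balaban1987-cmp109-rg-i-small-field` (journal page = PDF page + 248), `paper:balaban1988-cmp116-rg-ii-cluster`;
(2.9) p. 266 re-read this session; (2.22), (2.25) through the tree's certified readings.

CITATION HEADER / WHAT IS REPRODUCED (cell `pub-ymgap`, HUMAN RULING D-0062 Track A, seat `pub-ymgap-dag-n22-b` = the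
FIRST-MISSING-ESTIMATE seat of DAG node N22 = NE9; seventh module of the body-level chain, a NEW LEAF over the seat's
`B12Eq213GaussianTiltedMoments` (`integral_exp_sq_gaussProb`, `gaussWeight_mul_exp_sq`) and `B12Eq213GaussianLastCoupling`
(`integrable_gaussProb_iff`), nothing there modified).

THE PRINT.  [I] (2.9) p. 266: *«χ_k = Π χ({|B′(b)| < ε₁})»* (in the integration variable of (2.13): radius `r = ε₁g_k⁻¹`, [II] (1.34));
[II] (2.22) p. 16: *«χ_{k,Y₀}(B)χᶜ_{k,P}(B) ≤ exp(−½γ₂(ε₁²/g_k²)|P| + ½γ₂‖PB‖²)»* (Chebyshev per large-field bond); (2.25) p. 17 (Gaussian integral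
of a small quadratic exponential).  The mass lower bound itself is NOT printed (print never divides by the small-field mass: its
normalisations are the brackets `[log Z^{(k)}(U) − log Z^{(k)}(1)]`, `log 𝐍″_k` of (2.12)–(2.14)); it is the denominator the seat's
un-localised body-level bounds carry.

WHAT THIS MODULE DOES (THEOREMS ONLY; no definition, no named fact).  For the Gaussian datum with precision `M = prec U` and a product
cut-off `χ_U = Π_{b∈S} 1{|B_b| < r}` over finitely many coordinates:
* `one_sub_chi_le_largeField` — `1 − χ_U ≤ Σ_{b∈S} 1{r ≤ |B_b|} ≤ e^{−½γ₂r²}·Σ_{b∈S} e^{½γ₂B_b²}` (union bound, as in module 2's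
  `gap_of_nested_product`, + the (2.22) device `B13.indicator_le_exp_222`);
* **`smallFieldMass_ge`** — for `0 ≤ α`, `0 ≤ γ₂`, `M + α·1` and `M + (α − γ₂)·1` positive definite (and `χ_U` measurable):
  `∫ χ_U e^{−½α|B|²} dμ_{M⁻¹} ≥ √(det M)∕√(det(M + α·1)) − e^{−½γ₂r²}·#S·√(det M)∕√(det(M + (α−γ₂)·1))` — positive as soon as the
  large-field factor `e^{−½γ₂r²} = e^{−½γ₂ε₁²/g_k²}` beats `#S` times the ratio of the two Gaussian quantities: the EXPLICIT denominator for
  `hasDerivAt_newTerm_gaussian_of_quadDom` ∕ `abs_newTerm_sub_newTerm_gaussian_of_quadDom` ∕ `cutoffChannel_gaussian_le`.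
HONEST READING: Gaussian bookkeeping on the typed body; what makes `S`, `r`, `M` Bałaban's is W1 (NODE 00 ∕ substrate).

HONEST FRAMING: count-neutral Track-A side module; NOT a discharge of node N22; one finite T⁴ programme at fixed ε, Bałaban AS PRINTED with
locators; nothing continuum ∕ ℝ⁴ ∕ OS ∕ mass-gap ∕ Clay.
-/

noncomputable section

namespace Literature.MathematicalPhysics.QuantumFieldTheory.Balaban1983to89.B12Eq213GaussianSmallFieldMass

open _root_.MeasureTheory Matrix
open scoped BigOperators
open Literature.MathematicalPhysics.QuantumFieldTheory.Balaban1983to89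
open Literature.MathematicalPhysics.QuantumFieldTheory.Balaban1983to89.B13GaugeDevices (gaussWeight gaussNorm gaussMean gaussInt)
open Literature.MathematicalPhysics.QuantumFieldTheory.Balaban1983to89.B2Eq228Conditioning (gaussProb gaussNorm_pos gaussWeight_pos
  integrable_gaussWeight isProbabilityMeasure_gaussProb)
open Literature.MathematicalPhysics.QuantumFieldTheory.Balaban1983to89.B12Eq213GaussianTiltedMoments
open Literature.MathematicalPhysics.QuantumFieldTheory.Balaban1983to89.B12Eq213GaussianLastCoupling (integrable_gaussProb_iff)

variable {X : Type*} {κ : Type} [Fintype κ] [DecidableEq κ]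
variable (prec : X → Matrix κ κ ℝ) (hpd : ∀ U, (prec U).PosDef) (χ : X → (κ → ℝ) → ℝ)

omit [Fintype κ] [DecidableEq κ] in
/-- `1 − Π_{b∈S}(1 − a_b) ≤ Σ_{b∈S} a_b` for `a_b ∈ [0, 1]` (union bound; plumbing, as in module 2). [folklore] -/
private theorem one_sub_prod_one_sub_le_sum (S : Finset κ) (a : κ → ℝ) (ha0 : ∀ b ∈ S, 0 ≤ a b)
    (ha1 : ∀ b ∈ S, a b ≤ 1) : 1 - ∏ b ∈ S, (1 - a b) ≤ ∑ b ∈ S, a b := by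
  classical
  induction S using Finset.induction_on with
  | empty => simp
  | insert b S hb ih =>
    rw [Finset.prod_insert hb, Finset.sum_insert hb]
    have h0b : 0 ≤ a b := ha0 b (Finset.mem_insert_self b S)
    have h1b : a b ≤ 1 := ha1 b (Finset.mem_insert_self b S)
    have hP0 : 0 ≤ ∏ x ∈ S, (1 - a x) :=
      Finset.prod_nonneg fun x hx => sub_nonneg.2 (ha1 x (Finset.mem_insert_of_mem hx))
    have hP1 : ∏ x ∈ S, (1 - a x) ≤ 1 :=
      Finset.prod_le_one (fun x hx => sub_nonneg.2 (ha1 x (Finset.mem_insert_of_mem hx)))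
        fun x hx => sub_le_self 1 (ha0 x (Finset.mem_insert_of_mem hx))
    have ih' := ih (fun x hx => ha0 x (Finset.mem_insert_of_mem hx)) fun x hx => ha1 x (Finset.mem_insert_of_mem hx)
    nlinarith

omit [Fintype κ] [DecidableEq κ] in
/-- **THE COMPLEMENT OF THE PRODUCT CUT-OFF LIVES ON THE LARGE FIELD, WITH THE (2.22) FACTOR**: for `χ_U = Π_{b∈S} 1{|B_b| < r}`
(`0 ≤ r`, `0 ≤ γ₂`), `1 − χ_U(B) ≤ e^{−½γ₂r²}·Σ_{b∈S} e^{½γ₂B_b²}` (union bound, then `1{r ≤ |x|} ≤ exp(½γ₂(x² − r²))` =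
`B13.indicator_le_exp_222`). [cite: Balaban1988RG2Cluster, (2.22) p.16; Balaban1987RG1, (2.9) p.266] -/
theorem one_sub_chi_le_largeField (S : Finset κ) {r γ₂ : ℝ} (hr : 0 ≤ r) (hγ : 0 ≤ γ₂) {U : X}
    (hprod : ∀ B, χ U B = ∏ b ∈ S, (if |B b| < r then (1 : ℝ) else 0)) (B : κ → ℝ) :
    1 - χ U B ≤ Real.exp (-(γ₂ / 2 * r ^ 2)) * ∑ b ∈ S, Real.exp (γ₂ / 2 * (B b) ^ 2) := by
  have e : ∀ b ∈ S, (if |B b| < r then (1 : ℝ) else 0) = 1 - (if r ≤ |B b| then (1 : ℝ) else 0) := by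
    intro b _
    by_cases h : r ≤ |B b|
    · simp [h, not_lt.2 h]
    · simp [h, not_le.1 h]
  rw [hprod B, Finset.prod_congr rfl e]
  have hgap := one_sub_prod_one_sub_le_sum S (fun b => if r ≤ |B b| then (1 : ℝ) else 0)
    (fun b _ => by split_ifs <;> norm_num) (fun b _ => by split_ifs <;> norm_num)
  refine hgap.trans ?_
  rw [Finset.mul_sum]
  refine Finset.sum_le_sum fun b _ => ?_
  calc (if r ≤ |B b| then (1 : ℝ) else 0) ≤ Real.exp (γ₂ / 2 * ((B b) ^ 2 - r ^ 2)) :=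
        B13.indicator_le_exp_222 (B b) r γ₂ hγ hr
    _ = Real.exp (-(γ₂ / 2 * r ^ 2)) * Real.exp (γ₂ / 2 * (B b) ^ 2) := by rw [← Real.exp_add]; ring_nf

include hpd in
/-- **THE DAMPED SMALL-FIELD MASS IS BOUNDED BELOW EXPLICITLY**: for the product cut-off `χ_U = Π_{b∈S} 1{|B_b| < r}` (measurable),
`0 ≤ α`, `0 ≤ γ₂`, and `M + α·1`, `M + (α − γ₂)·1` positive definite (`M = prec U`),
`∫ χ_U e^{−½α|B|²} dμ_{M⁻¹} ≥ √(det M)∕√(det(M + α·1)) − e^{−½γ₂r²}·#S·√(det M)∕√(det(M + (α − γ₂)·1))` — the first term is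
`∫ e^{−½α|B|²} dμ_{M⁻¹}` ((2.25) at precision `M`, `c = −α`), the second the large-field correction ((2.22) device, then (2.25) at
`c = γ₂ − α` after `B_b² ≤ |B|²`).  With `r = ε₁g_k⁻¹` the correction carries `exp(−½γ₂ε₁²/g_k²)`.
[cite: Balaban1988RG2Cluster, (2.22) p.16 and (2.25) p.17; Balaban1987RG1, (2.9) p.266 and (2.13) p.268] -/
theorem smallFieldMass_ge (S : Finset κ) {r γ₂ α : ℝ} (hr : 0 ≤ r) (hγ : 0 ≤ γ₂) (hα : 0 ≤ α) {U : X}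
    (hprod : ∀ B, χ U B = ∏ b ∈ S, (if |B b| < r then (1 : ℝ) else 0))
    (hχm : AEStronglyMeasurable (χ U) (gaussProb (prec U)))
    (hMα : (prec U - (-α) • (1 : Matrix κ κ ℝ)).PosDef) (hMγ : (prec U - (γ₂ - α) • (1 : Matrix κ κ ℝ)).PosDef) :
    Real.sqrt (prec U).det / Real.sqrt (prec U - (-α) • (1 : Matrix κ κ ℝ)).det
        - Real.exp (-(γ₂ / 2 * r ^ 2)) * ((S.card : ℝ) *
            (Real.sqrt (prec U).det / Real.sqrt (prec U - (γ₂ - α) • (1 : Matrix κ κ ℝ)).det))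
      ≤ ∫ B, χ U B * Real.exp (-(α / 2 * (B ⬝ᵥ B))) ∂(gaussProb (prec U)) := by
  haveI := isProbabilityMeasure_gaussProb (hpd U)
  have hχ0 : ∀ B, 0 ≤ χ U B := fun B => by
    rw [hprod B]; exact Finset.prod_nonneg fun b _ => by split_ifs <;> norm_num
  have hχ1 : ∀ B, χ U B ≤ 1 := fun B => by
    rw [hprod B]
    exact Finset.prod_le_one (fun b _ => by split_ifs <;> norm_num) fun b _ => by split_ifs <;> norm_num
  have hx0 : ∀ B : κ → ℝ, 0 ≤ B ⬝ᵥ B := fun B => Finset.sum_nonneg fun i _ => mul_self_nonneg (B i)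
  have hcoord : ∀ (b : κ) (B : κ → ℝ), (B b) ^ 2 ≤ B ⬝ᵥ B := by
    intro b B
    rw [dotProduct, sq]
    exact Finset.single_le_sum (f := fun i => B i * B i) (fun i _ => mul_self_nonneg (B i)) (Finset.mem_univ b)
  -- the two Gaussian integrals
  have hI0 : ∫ B, Real.exp (-(α / 2 * (B ⬝ᵥ B))) ∂(gaussProb (prec U))
      = Real.sqrt (prec U).det / Real.sqrt (prec U - (-α) • (1 : Matrix κ κ ℝ)).det := by
    rw [← integral_exp_sq_gaussProb (hpd U) hMα]
    refine integral_congr_ae (Filter.Eventually.of_forall fun B => ?_)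
    ring_nf
  have hIb : ∀ b ∈ S, ∫ B, Real.exp (γ₂ / 2 * (B b) ^ 2) * Real.exp (-(α / 2 * (B ⬝ᵥ B))) ∂(gaussProb (prec U))
      ≤ Real.sqrt (prec U).det / Real.sqrt (prec U - (γ₂ - α) • (1 : Matrix κ κ ℝ)).det := by
    intro b _
    rw [← integral_exp_sq_gaussProb (hpd U) hMγ]
    have hmaj : Integrable (fun B : κ → ℝ => Real.exp ((γ₂ - α) / 2 * (B ⬝ᵥ B))) (gaussProb (prec U)) := by
      rw [integrable_gaussProb_iff (hpd U)]
      refine (integrable_gaussWeight hMγ).congr (Filter.Eventually.of_forall fun B => ?_)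
      simp only [← gaussWeight_mul_exp_sq]
    refine integral_mono_of_nonneg (Filter.Eventually.of_forall fun B => mul_nonneg (Real.exp_nonneg _) (Real.exp_nonneg _))
      hmaj (Filter.Eventually.of_forall fun B => ?_)
    have hl : γ₂ / 2 * (B b) ^ 2 ≤ γ₂ / 2 * (B ⬝ᵥ B) := mul_le_mul_of_nonneg_left (hcoord b B) (by linarith)
    calc Real.exp (γ₂ / 2 * (B b) ^ 2) * Real.exp (-(α / 2 * (B ⬝ᵥ B)))
        ≤ Real.exp (γ₂ / 2 * (B ⬝ᵥ B)) * Real.exp (-(α / 2 * (B ⬝ᵥ B))) :=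
          mul_le_mul_of_nonneg_right (Real.exp_le_exp.2 hl) (Real.exp_nonneg _)
      _ = Real.exp ((γ₂ - α) / 2 * (B ⬝ᵥ B)) := by rw [← Real.exp_add]; ring_nf
  -- integrability of the pieces
  have hint_exp : Integrable (fun B : κ → ℝ => Real.exp (-(α / 2 * (B ⬝ᵥ B)))) (gaussProb (prec U)) := by
    refine (integrable_const (1 : ℝ)).mono' (Continuous.aestronglyMeasurable (by fun_prop))
      (Filter.Eventually.of_forall fun B => ?_)
    rw [Real.norm_eq_abs, abs_of_nonneg (Real.exp_nonneg _)]
    exact Real.exp_le_one_iff.2 (by nlinarith [hx0 B])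
  have hint_b : ∀ b ∈ S, Integrable (fun B : κ → ℝ => Real.exp (γ₂ / 2 * (B b) ^ 2) * Real.exp (-(α / 2 * (B ⬝ᵥ B))))
      (gaussProb (prec U)) := by
    intro b _
    have hmaj : Integrable (fun B : κ → ℝ => Real.exp ((γ₂ - α) / 2 * (B ⬝ᵥ B))) (gaussProb (prec U)) := by
      rw [integrable_gaussProb_iff (hpd U)]
      refine (integrable_gaussWeight hMγ).congr (Filter.Eventually.of_forall fun B => ?_)
      simp only [← gaussWeight_mul_exp_sq]
    refine hmaj.mono' (Continuous.aestronglyMeasurable (by fun_prop)) (Filter.Eventually.of_forall fun B => ?_)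
    rw [Real.norm_eq_abs, abs_of_nonneg (mul_nonneg (Real.exp_nonneg _) (Real.exp_nonneg _))]
    have hl : γ₂ / 2 * (B b) ^ 2 ≤ γ₂ / 2 * (B ⬝ᵥ B) := mul_le_mul_of_nonneg_left (hcoord b B) (by linarith)
    calc Real.exp (γ₂ / 2 * (B b) ^ 2) * Real.exp (-(α / 2 * (B ⬝ᵥ B)))
        ≤ Real.exp (γ₂ / 2 * (B ⬝ᵥ B)) * Real.exp (-(α / 2 * (B ⬝ᵥ B))) :=
          mul_le_mul_of_nonneg_right (Real.exp_le_exp.2 hl) (Real.exp_nonneg _)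
      _ = Real.exp ((γ₂ - α) / 2 * (B ⬝ᵥ B)) := by rw [← Real.exp_add]; ring_nf
  have hint_sum : Integrable (fun B : κ → ℝ => Real.exp (-(γ₂ / 2 * r ^ 2)) *
      ∑ b ∈ S, Real.exp (γ₂ / 2 * (B b) ^ 2) * Real.exp (-(α / 2 * (B ⬝ᵥ B)))) (gaussProb (prec U)) :=
    (integrable_finsetSum S fun b hb => hint_b b hb).const_mul _
  have hint_χ : Integrable (fun B => χ U B * Real.exp (-(α / 2 * (B ⬝ᵥ B)))) (gaussProb (prec U)) := by
    refine (integrable_const (1 : ℝ)).mono' (hχm.mul (Continuous.aestronglyMeasurable (by fun_prop)))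
      (Filter.Eventually.of_forall fun B => ?_)
    rw [Real.norm_eq_abs, abs_of_nonneg (mul_nonneg (hχ0 B) (Real.exp_nonneg _))]
    calc χ U B * Real.exp (-(α / 2 * (B ⬝ᵥ B))) ≤ 1 * 1 :=
          mul_le_mul (hχ1 B) (Real.exp_le_one_iff.2 (by nlinarith [hx0 B])) (Real.exp_nonneg _) zero_le_one
      _ = 1 := one_mul 1
  -- pointwise: χ e^{-½α|B|²} ≥ e^{-½α|B|²} − e^{-½γ₂r²} Σ_b e^{½γ₂B_b²} e^{-½α|B|²}
  have hpt : ∀ B, Real.exp (-(α / 2 * (B ⬝ᵥ B))) - Real.exp (-(γ₂ / 2 * r ^ 2)) *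
      ∑ b ∈ S, Real.exp (γ₂ / 2 * (B b) ^ 2) * Real.exp (-(α / 2 * (B ⬝ᵥ B)))
        ≤ χ U B * Real.exp (-(α / 2 * (B ⬝ᵥ B))) := by
    intro B
    have h := one_sub_chi_le_largeField χ S hr hγ hprod B
    have he : 0 ≤ Real.exp (-(α / 2 * (B ⬝ᵥ B))) := Real.exp_nonneg _
    have hmul := mul_le_mul_of_nonneg_right h he
    have e : Real.exp (-(γ₂ / 2 * r ^ 2)) * (∑ b ∈ S, Real.exp (γ₂ / 2 * (B b) ^ 2)) * Real.exp (-(α / 2 * (B ⬝ᵥ B)))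
        = Real.exp (-(γ₂ / 2 * r ^ 2)) * ∑ b ∈ S, Real.exp (γ₂ / 2 * (B b) ^ 2) * Real.exp (-(α / 2 * (B ⬝ᵥ B))) := by
      rw [mul_assoc, Finset.sum_mul]
    rw [e] at hmul
    linarith [hmul]
  -- integrate
  have hmono : ∫ B, (Real.exp (-(α / 2 * (B ⬝ᵥ B))) - Real.exp (-(γ₂ / 2 * r ^ 2)) *
      ∑ b ∈ S, Real.exp (γ₂ / 2 * (B b) ^ 2) * Real.exp (-(α / 2 * (B ⬝ᵥ B)))) ∂(gaussProb (prec U))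
        ≤ ∫ B, χ U B * Real.exp (-(α / 2 * (B ⬝ᵥ B))) ∂(gaussProb (prec U)) :=
    integral_mono (hint_exp.sub hint_sum) hint_χ hpt
  rw [integral_sub hint_exp hint_sum, integral_const_mul, integral_finsetSum S (fun b hb => hint_b b hb), hI0] at hmono
  refine le_trans ?_ hmono
  have hsum : ∑ b ∈ S, ∫ B, Real.exp (γ₂ / 2 * (B b) ^ 2) * Real.exp (-(α / 2 * (B ⬝ᵥ B))) ∂(gaussProb (prec U))
      ≤ (S.card : ℝ) * (Real.sqrt (prec U).det / Real.sqrt (prec U - (γ₂ - α) • (1 : Matrix κ κ ℝ)).det) := by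
    have h := Finset.sum_le_sum hIb
    rwa [Finset.sum_const, nsmul_eq_mul] at h
  have hfac : 0 ≤ Real.exp (-(γ₂ / 2 * r ^ 2)) := Real.exp_nonneg _
  nlinarith [mul_le_mul_of_nonneg_left hsum hfac]

end Literature.MathematicalPhysics.QuantumFieldTheory.Balaban1983to89.B12Eq213GaussianSmallFieldMass
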